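import Summits.QuantumFields.BalabanUV.Beta.SymRootedT2JetDictionary
import Summits.QuantumFields.BalabanUV.Beta.SymRootedMixedJetSingle
import Summits.QuantumFields.BalabanUV.Beta.SymRootedJetLinear
import Summits.QuantumFields.BalabanUV.Beta.RootedT2JetSingle

/-!
# `BalabanUV.Beta.SymRootedT2JetSingle` — EVERY TERM OF THE (0.4)-SYMMETRISED `symT2At` REFLECTION LAWS AT SINGLE LETTERS, AS A SYM COUNT
# (β sub-cell, row D1, TABLES-SYM-LEAN S2c∕S2d, INTERFACE-LEVEL twin of an3's 33K1 `RootedT2JetSingle`; an1 gen 43; the border REFLECTION path)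

HONEST FRAMING (cell charter, verbatim): «discharging BetaPertH makes Bałaban's UV stability UNCONDITIONAL — a real
constructive-QFT result; it is NOT the continuum limit and NOT the Clay problem.»  HONEST DEPENDENCY (verbatim): «continuum YM on
T⁴ ⇐ BetaPertH ∧ nine spine estimates (0/9 proved); BetaPertH ⇐ (D1) ∧ (D4) ∧ CAP+tail; G-an2-4 gates asym, D1 and NE2/3/4.»
ABSOLUTE RULE (R-g25-7 ∕ R-D1-g30-1 (A)): the (0.4)-symmetrised averaging is the exp of the MEAN OF LOGS over the pair family
`{loop^{σ,σ′}}` with weight `((d!)²·L^d)⁻¹`; every object below is the comb module's algebra read on an1's `symPhiGAt` (S2b part 1)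
instead of `PhiGAt` — STATEMENT FOR STATEMENT under the dictionary `PhiXAt ↦ symPhiXAt`, `XjetAt ↦ symXjetAt`, `MσXAt ↦ symMσXAt`,
`L^{-d}·linAvgAt ↦ (d!·L^d)⁻¹·symLinU`, `L^{-d}·hessUAt ↦ ((d!)²L^d)⁻¹·symHessUAt`, `L^{-2d}·vhUAt ↦ ((d!)²L^{2d})⁻¹·symVhUAt`
(an3-g63 [AN3-G63-S2C] (C-ii): constants PER BCH ORDER; CONVENTION `(d!)²` un-normalised inside order-2 sym functionals).
FAMILY-INDEPENDENT chart ∕ letter ∕ `Tau`-algebra lemmas of the comb module are imported BY NAME, never re-proved.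
DERIVED cell leaf: [folklore] ring algebra; the `sym*` families are [our object]s.  No statement of Bałaban's papers is typed here, no
`[cite:]` tag, no `Prop` is minted, no binder of the β-function wall (`hW`/`hR`/`D1Tel`/`D1Rep`, (D1), `BetaPertH`) is instantiated or
discharged; nothing about the VALUES of `symMixFFAt`∕`symVh₂SAt` and no (T2-B)∕(T2-M₂) letter is discharged in this file.
NOT D1, NOT BetaPertH, NOT continuum, NOT Clay.  NOT summit progress.
Provenance: β sub-cell, TABLES-SYM-LEAN S2c option (C) (S2C-SCOPE-v1 94facb80ac685517), unit b2b-balaban-beta-an1-g43 (W-supplier AN1,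
FREEZE (0): scratch for a courier; an1 files nothing), 2026-08-21; no existing file touched.

## What this module proves (sym twin of `RootedT2JetSingle` §2–§4; its §1 background letters `dR_eq_D1R dR_of_single A12R_of_single` and §4's
## `R1g_single_signed` are letter algebra, the comb module's BY NAME)
* §2 **`symT2At_bref`** (`L` odd, char ≠ 2): 33I-sym's two laws as one — `symT2At ω B B′ = ε_μ • (symT2At ω♯ B♯ B′♯ + symCT(B,B′) + symCT(B′,B)
  + [μ = α]·(symCJ(B,B′) + symCJ(B′,B)))` at the reflected block (an1's `SymRootedT2JetReflection.symT2At_sref_of_ne`, `symT2At_bref_self`).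
* §3 **`symCT_upF`, `symCT_of_single`, `c10/c01/c11_symNR_of_single`, `X00/X01/X10_of_single`** — the components at single letters in the LANDED sym
  counts `symVhCountAt`, `symHessCountAt`, `symLinCountAt` (`SymAveragingHessianCountsWords`: `symVhUAt_single`, `symHessUAt_single`, `symLinU_single`), with
  the sym constants `(2L^{2d})⁻¹ ↦ (2(d!)²L^{2d})⁻¹`, `(2L^d)⁻¹ ↦ (2(d!)²L^d)⁻¹`, `L^{-d} ↦ (d!·L^d)⁻¹`, `[G = H]·q ↦ d!·[G = H]·q_sym` (an1's
  `SymRootedT2JetDictionary.c**_symQjetAt_upF`, `c**_symNR`); every statement carries `(hd : ((d ! : ℕ) : 𝕜) ≠ 0)` before `hL`.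
* §4 `symT2At_upF_single_signs` (the signs of `R1g_single` pull out of `symT2At`: an1's `symT2At_neg_ω`, `symT2At_upF_neg_B/_B'`).
-/

namespace Summit.QuantumFields.BalabanUV.Beta.SymRootedT2JetSingle

open Literature.MathematicalPhysics.QuantumFieldTheory.Balaban1983to89
open Literature.MathematicalPhysics.QuantumFieldTheory.Balaban1983to89.Beta
open scoped Nat
open AffineAveraging (Form1)
open AveragingContoursRooted (ctr)
open AveragingHessianKernels (Bond single single_apply bw bw_single)
open Summit.QuantumFields.BalabanUV.Beta.SymAveragingHessianCounts (symHessUAt symVhUAt symLinU symLinCountAt symHessCountAt symVhCountAt symLinU_single symHessUAt_single symVhUAt_single)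
open AveragingThirdJet (Tau upF)
open AveragingThirdJet.Tau (c00 c10 c01 c11)
open Summit.QuantumFields.BalabanUV.Beta.SymAveragingMixedJetTables (symQjetAt symT2At)
open ResolventReflection (sref bref bref_of_ne)
open RootedKernelReflection (fref)
open Summit.QuantumFields.BalabanUV.Beta.RootedHolonomyReflection (R1g)
open Summit.QuantumFields.BalabanUV.Beta.RootedJetReflectionExpanded (dR ad1R ad12R)
open Summit.QuantumFields.BalabanUV.Beta.SymRootedJetLinear (symT2At_neg_ω)
open Summit.QuantumFields.BalabanUV.Beta.RootedMixedJetLinear (upF_neg)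
open Summit.QuantumFields.BalabanUV.Beta.RootedMixedJetReflectionLaw (D1R)
open Summit.QuantumFields.BalabanUV.Beta.RootedMixedJetSigns (R1g_single)
open Summit.QuantumFields.BalabanUV.Beta.RootedMixedJetSingle (D1R_of_single single_neg)
open Summit.QuantumFields.BalabanUV.Beta.SymRootedT2JetReflection (symCT symNR symCJ symT2At_sref_of_ne symT2At_bref_self)
open Summit.QuantumFields.BalabanUV.Beta.RootedT2JetDictionary (R1g_upF ad1R_upF A12R ad12R_upF)
open Summit.QuantumFields.BalabanUV.Beta.SymRootedT2JetDictionary (symT2At_upF_neg_B symT2At_upF_neg_B' c00_symQjetAt_upF c10_symQjetAt_upF c01_symQjetAt_upF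
  c10_symNR c01_symNR c11_symNR)
open Summit.QuantumFields.BalabanUV.Beta.RootedT2JetSingle (dR_eq_D1R dR_of_single A12R_of_single R1g_single_signed)

variable {𝕜 : Type*} [Field 𝕜] {d : ℕ} {𝔸 : Type*} [Ring 𝔸] [Algebra 𝕜 𝔸]

/-! ## §1 The background letters `dR`, `A12R` at single letters: letter algebra, the comb module's `dR_eq_D1R dR_of_single A12R_of_single` BY NAME -/

/-! ## §2 The one combined reflection law of `symT2At` at the reflected block -/

section Law

variable (𝕜) {L : ℕ} (hL : Odd L) (h2 : (2 : 𝕜) ≠ 0)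
include hL h2

/-- [folklore] **33I's TWO LAWS AS ONE**: at the reflected block `(μ, bref α μ y)` (`bref = sref` off the axis),
`symT2At ω B B′ = ε_μ • (symT2At ω♯ B♯ B′♯ + symCT(B,B′) + symCT(B′,B) + [μ = α]·(symCJ(B,B′) + symCJ(B′,B)))` at `(μ, y)`, `ε_μ = −1` iff `μ = α`
(33I `symT2At_sref_of_ne`, `symT2At_bref_self`). -/
theorem symT2At_bref (α μ : Fin d) (ω : Form1 d (Tau 𝔸)) (B B' : Form1 d 𝔸) (y : Fin d → ℤ) :
    symT2At 𝕜 (ctr d L) ω B B' L μ (bref α μ y)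
      = (if μ = α then -1 else 1 : ℤ) •
        (symT2At 𝕜 (ctr d L) (R1g α ω) (R1g α B) (R1g α B') L μ y
          + symCT 𝕜 (ctr d L) α ω B B' L μ y + symCT 𝕜 (ctr d L) α ω B' B L μ y
          + (if μ = α then symCJ 𝕜 (ctr d L) α ω B B' L μ y + symCJ 𝕜 (ctr d L) α ω B' B L μ y else 0)) := by
  by_cases hμ : μ = α
  · subst hμ
    rw [symT2At_bref_self 𝕜 hL h2, if_pos rfl, if_pos rfl, neg_one_zsmul]
    abel
  · rw [bref_of_ne hμ, symT2At_sref_of_ne 𝕜 hL hμ, if_neg hμ, if_neg hμ, one_zsmul, add_zero]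

end Law

/-! ## §3 The components at single letters, every one a count -/

section Components

variable {L : ℕ} (hd : ((d ! : ℕ) : 𝕜) ≠ 0) (hL : (L : 𝕜) ≠ 0) (h2 : (2 : 𝕜) ≠ 0) (ρ : Fin d → ℤ)
include hd hL

include h2 in
/-- [folklore] 33I's `symCT` AT A SCALAR FLUCTUATION `ω = upF W`, IN NODE-7aρ FUNCTIONALS (33J §1, §4):
`symCT = (2(d!)²ℓ²)⁻¹ • (symVhUAt ρ (D1R α W · B) c + symVhUAt ρ (D1R α W · B′) b) + (d!·ℓ)⁻¹ • Z_sym(A12R α W B B′)`. -/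
theorem symCT_upF (α : Fin d) (W B B' : Form1 d 𝔸) (μ : Fin d) (y : Fin d → ℤ) :
    symCT 𝕜 ρ α (upF W) B B' L μ y
      = ((2 : 𝕜) * ((d ! : 𝕜) ^ 2 * (L : 𝕜) ^ (2 * d)))⁻¹ • (symVhUAt ρ (D1R α W W B) (R1g α B') L μ y + symVhUAt ρ (D1R α W W B') (R1g α B) L μ y)
        + ((d ! : 𝕜) * (L : 𝕜) ^ d)⁻¹ • symLinU ρ (A12R α W B B') L μ y := by
  simp only [symCT, ad1R_upF, ad12R_upF, c01_symQjetAt_upF hd hL h2, c10_symQjetAt_upF hd hL h2, c00_symQjetAt_upF hd hL, smul_add]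

variable {α : Fin d} {W B B' : Form1 d 𝔸} {F G H : Bond d} {w p q : 𝔸}

include h2 in
/-- [folklore] **`symCT` AT SINGLE LETTERS** (`symCT_upF`, 33M3c `D1R_of_single`, §1 `A12R_of_single`, node 7aρ `symVhUAt_single`,
`symLinU_single`). -/
theorem symCT_of_single (hW : R1g α W = single F w) (hB : R1g α B = single G p) (hB' : R1g α B' = single H q) (μ : Fin d)
    (y : Fin d → ℤ) :
    symCT 𝕜 ρ α (upF W) B B' L μ y
      = ((2 : 𝕜) * ((d ! : 𝕜) ^ 2 * (L : 𝕜) ^ (2 * d)))⁻¹ •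
          (symVhCountAt ρ L μ y F H •
              AveragingHessianKernels.comm (if F = G ∧ F.1 = α then AveragingHessianKernels.comm p w else 0) q
            + symVhCountAt ρ L μ y F G •
              AveragingHessianKernels.comm (if F = H ∧ F.1 = α then AveragingHessianKernels.comm q w else 0) p)
        + ((d ! : 𝕜) * (L : 𝕜) ^ d)⁻¹ • (symLinCountAt ρ L μ y F •
            (if F = G ∧ F = H ∧ F.1 = α then AveragingHessianKernels.comm q (AveragingHessianKernels.comm p w) else 0)) := by
  rw [symCT_upF hd hL h2, D1R_of_single hW hB W, D1R_of_single hW hB' W, hB, hB', A12R_of_single hW hB hB', symVhUAt_single,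
    symVhUAt_single, symLinU_single]

/-- [folklore] `c10 symNR = ℓ⁻¹ • Z_G • p` at a single first background (33J `c10_symNR`). -/
theorem c10_symNR_of_single (hB : R1g α B = single G p) (B' : Form1 d 𝔸) (μ : Fin d) (y : Fin d → ℤ) :
    c10 (symNR 𝕜 ρ α B B' L μ y) = ((d ! : 𝕜) * (L : 𝕜) ^ d)⁻¹ • (symLinCountAt ρ L μ y G • p) := by
  rw [c10_symNR hd hL, hB, symLinU_single]

/-- [folklore] `c01 symNR = ℓ⁻¹ • Z_H • q` at a single second background (33J `c01_symNR`). -/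
theorem c01_symNR_of_single (hB' : R1g α B' = single H q) (B : Form1 d 𝔸) (μ : Fin d) (y : Fin d → ℤ) :
    c01 (symNR 𝕜 ρ α B B' L μ y) = ((d ! : 𝕜) * (L : 𝕜) ^ d)⁻¹ • (symLinCountAt ρ L μ y H • q) := by
  rw [c01_symNR hd hL, hB', symLinU_single]

include h2 in
/-- [folklore] **`c11 symNR` AT SINGLE LETTERS** (33J `c11_symNR`; node 7aρ `symHessUAt_single`, node 7a `bw_single`, §1 `dR_of_single`):
`(2(d!)²ℓ)⁻¹ • (h_sym(G,H) • [p,q] + d!·Z_G • [G=H]·[p,q]) + (d!·ℓ)⁻¹ • (Z_G • [G=H ax]·[q,p]) + (2(d!)²ℓ²)⁻¹ • {Z_G • p, Z_H • q}`. -/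
theorem c11_symNR_of_single (hB : R1g α B = single G p) (hB' : R1g α B' = single H q) (μ : Fin d) (y : Fin d → ℤ) :
    c11 (symNR 𝕜 ρ α B B' L μ y)
      = ((2 : 𝕜) * ((d ! : 𝕜) ^ 2 * (L : 𝕜) ^ d))⁻¹ •
          (symHessCountAt ρ L μ y G H • AveragingHessianKernels.comm p q
            + (d ! : ℤ) • (symLinCountAt ρ L μ y G • (if G = H then AveragingHessianKernels.comm p q else 0)))
        + ((d ! : 𝕜) * (L : 𝕜) ^ d)⁻¹ • (symLinCountAt ρ L μ y G • (if G = H ∧ G.1 = α then AveragingHessianKernels.comm q p else 0))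
        + ((2 : 𝕜) * ((d ! : 𝕜) ^ 2 * (L : 𝕜) ^ (2 * d)))⁻¹ •
          ((symLinCountAt ρ L μ y G • p) * (symLinCountAt ρ L μ y H • q) + (symLinCountAt ρ L μ y H • q) * (symLinCountAt ρ L μ y G • p)) := by
  rw [c11_symNR hd hL h2, dR_of_single hB hB', hB, hB', symHessUAt_single, bw_single]
  simp only [symLinU_single]

/-- [folklore] THE SHADOW COMPONENT `X₀₀ = c00 Q(ω♯; b, c) = ℓ⁻¹ • Z_F • w` (33J `R1g_upF`, `c00_symQjetAt_upF`). -/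
theorem X00_of_single (hW : R1g α W = single F w) (B B' : Form1 d 𝔸) (μ : Fin d) (y : Fin d → ℤ) :
    c00 (symQjetAt 𝕜 ρ (R1g α (upF W)) (R1g α B) (R1g α B') L μ y) = ((d ! : 𝕜) * (L : 𝕜) ^ d)⁻¹ • (symLinCountAt ρ L μ y F • w) := by
  rw [R1g_upF, hW, c00_symQjetAt_upF hd hL, symLinU_single]

include h2 in
/-- [folklore] THE COMPONENT `X₀₁ = c01 Q(ω♯; b, c) + c00 Q(ad1R α ω B′; b, c)` of 33I's `symCJ` at single letters:
`(2ℓ²)⁻¹ • v(F,H) • [w,q] + ℓ⁻¹ • Z_F • [F=H ax]·[q,w]`. -/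
theorem X01_of_single (hW : R1g α W = single F w) (hB' : R1g α B' = single H q) (B : Form1 d 𝔸) (μ : Fin d) (y : Fin d → ℤ) :
    c01 (symQjetAt 𝕜 ρ (R1g α (upF W)) (R1g α B) (R1g α B') L μ y) + c00 (symQjetAt 𝕜 ρ (ad1R α (upF W) B') (R1g α B) (R1g α B') L μ y)
      = ((2 : 𝕜) * ((d ! : 𝕜) ^ 2 * (L : 𝕜) ^ (2 * d)))⁻¹ • (symVhCountAt ρ L μ y F H • AveragingHessianKernels.comm w q)
        + ((d ! : 𝕜) * (L : 𝕜) ^ d)⁻¹ • (symLinCountAt ρ L μ y F • (if F = H ∧ F.1 = α then AveragingHessianKernels.comm q w else 0)) := by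
  rw [R1g_upF, ad1R_upF, D1R_of_single hW hB' W, hW, hB', c01_symQjetAt_upF hd hL h2, c00_symQjetAt_upF hd hL, symVhUAt_single, symLinU_single]

include h2 in
/-- [folklore] THE COMPONENT `X₁₀ = c10 Q(ω♯; b, c) + c00 Q(ad1R α ω B; b, c)`: `(2ℓ²)⁻¹ • v(F,G) • [w,p] + ℓ⁻¹ • Z_F • [F=G ax]·[p,w]`. -/
theorem X10_of_single (hW : R1g α W = single F w) (hB : R1g α B = single G p) (B' : Form1 d 𝔸) (μ : Fin d) (y : Fin d → ℤ) :
    c10 (symQjetAt 𝕜 ρ (R1g α (upF W)) (R1g α B) (R1g α B') L μ y) + c00 (symQjetAt 𝕜 ρ (ad1R α (upF W) B) (R1g α B) (R1g α B') L μ y)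
      = ((2 : 𝕜) * ((d ! : 𝕜) ^ 2 * (L : 𝕜) ^ (2 * d)))⁻¹ • (symVhCountAt ρ L μ y F G • AveragingHessianKernels.comm w p)
        + ((d ! : 𝕜) * (L : 𝕜) ^ d)⁻¹ • (symLinCountAt ρ L μ y F • (if F = G ∧ F.1 = α then AveragingHessianKernels.comm p w else 0)) := by
  rw [R1g_upF, ad1R_upF, D1R_of_single hW hB W, hW, hB, c10_symQjetAt_upF hd hL h2, c00_symQjetAt_upF hd hL, symVhUAt_single, symLinU_single]

end Components

/-! ## §4 Signs -/

/-- [folklore] THE SIGNS OF `R1g_single` PULL OUT OF `symT2At` AT SINGLE LETTERS (33F `symT2At_neg_ω`, 33M1 `upF_neg`, 33M3c `single_neg`,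
33J `symT2At_upF_neg_B`, `symT2At_upF_neg_B′`). -/
theorem symT2At_upF_single_signs (ρ : Fin d → ℤ) (F G H : Bond d) (w p q : 𝔸) (P Q R : Prop) [Decidable P] [Decidable Q]
    [Decidable R] (L : ℕ) (μ : Fin d) (y : Fin d → ℤ) :
    symT2At 𝕜 ρ (upF (single F (if P then -w else w))) (single G (if Q then -p else p)) (single H (if R then -q else q)) L μ y
      = ((if P then -1 else 1 : ℤ) * (if Q then -1 else 1 : ℤ) * (if R then -1 else 1 : ℤ))
          • symT2At 𝕜 ρ (upF (single F w)) (single G p) (single H q) L μ y := by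
  split_ifs <;> simp [single_neg, upF_neg, symT2At_neg_ω, symT2At_upF_neg_B, symT2At_upF_neg_B']

end Summit.QuantumFields.BalabanUV.Beta.SymRootedT2JetSingle
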